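import Summits.CriticalPhenomena.Ising3DConformalLimit.Cruxes.IsingEuclidUpgradeR4NonGaussian.Lines.isotherm_saturation_lee_yang
import Summits.CriticalPhenomena.Ising3DConformalLimit.Theses.UnitLightCone
import Summits.CriticalPhenomena.Ising3DConformalLimit.Theses.ModularBoosts

/-!
# Bet-route aliases for the registered line `isotherm-saturation-lee-yang` (crux stmt-CriticalPhenomena-0636)

Strategist gen 2 (planner-cstrat-stmt-CriticalPhenomena-0636-s1-0, 2026-08-17), re-armed because the BET route of the
shared crux changed (UnitLightCone / ModularBoosts). The shared decl `IsingEuclidUpgradeR4NonGaussian` is textually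
identical in every route file (items are deduplicated by normalised signature), so the line's sorry-free composition
`IsothermSaturationLeeYang.IsingEuclidUpgradeR4NonGaussian_of : S2 → S1 → IsingEuclidUpgrade.IsingEuclidUpgradeR4NonGaussian`
concludes the bet routes' copies BY NAME through definitional unfolding. This file records the two aliases (no new
mathematics, no new stub; the live skeleton is untouched). A lead seated on either bet route closes its copy with the
same two stubs.
-/

noncomputable section

namespace Summit.CriticalPhenomena.Ising3DConformalLimit.Cruxes.IsingEuclidUpgradeR4NonGaussian.IsothermSaturationLeeYang

open Literature.Probability.LatticeModels Filter Set Finset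
open scoped Topology BigOperators

/-- COMPOSITION for the UnitLightCone copy of the shared decl (bet route per payload 2026-08-17). -/
theorem IsingEuclidUpgradeR4NonGaussian_of_unitLightCone :
    (∀ (L : ℕ) (t : ℝ), 0 ≤ t →
      0 < plusExpect 3 (criticalBeta 3) 0 (fun σ => Real.exp (t * ∑ x ∈ box 3 L, spinAt x σ)) ∧
      (plusExpect 3 (criticalBeta 3) 0 (fun σ => (∑ x ∈ box 3 L, spinAt x σ) ^ 2) * t -
          t ^ 3 * (3 * (plusExpect 3 (criticalBeta 3) 0 (fun σ => (∑ x ∈ box 3 L, spinAt x σ) ^ 2)) ^ 2 -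
            plusExpect 3 (criticalBeta 3) 0 (fun σ => (∑ x ∈ box 3 L, spinAt x σ) ^ 4))) *
        plusExpect 3 (criticalBeta 3) 0 (fun σ => Real.exp (t * ∑ x ∈ box 3 L, spinAt x σ)) ≤
      plusExpect 3 (criticalBeta 3) 0
        (fun σ => (∑ x ∈ box 3 L, spinAt x σ) * Real.exp (t * ∑ x ∈ box 3 L, spinAt x σ))) →
    (∀ (ρ : ℝ → ℝ) (Δ : ℝ) (S : CorrFamily 3), (∀ δ ∈ Set.Ioc (0:ℝ) 1, 0 < ρ δ) →
      HasPointwiseScalingLimit (criticalCorr 3) ρ S → IsNondegenerateTwoPoint S →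
      IsScaleCovariant Δ S →
      ∃ C : ℝ, 0 < C ∧ ∀ᶠ L : ℕ in atTop,
        (2 * (L : ℝ) + 1) ^ 3 * magnetizationInField 3 (criticalBeta 3)
            (C / Real.sqrt (plusExpect 3 (criticalBeta 3) 0 (fun σ => (∑ x ∈ box 3 L, spinAt x σ) ^ 2))) ≤
          criticalBeta 3 * C / 2 *
            Real.sqrt (plusExpect 3 (criticalBeta 3) 0 (fun σ => (∑ x ∈ box 3 L, spinAt x σ) ^ 2))) →
    Summit.CriticalPhenomena.Ising3DConformalLimit.Theses.UnitLightCone.IsingEuclidUpgradeR4NonGaussian :=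
  fun hdef hiso => IsingEuclidUpgradeR4NonGaussian_of hdef hiso

/-- COMPOSITION for the ModularBoosts copy of the shared decl (bet route per the strategist prompt 2026-08-17). -/
theorem IsingEuclidUpgradeR4NonGaussian_of_modularBoosts :
    (∀ (L : ℕ) (t : ℝ), 0 ≤ t →
      0 < plusExpect 3 (criticalBeta 3) 0 (fun σ => Real.exp (t * ∑ x ∈ box 3 L, spinAt x σ)) ∧
      (plusExpect 3 (criticalBeta 3) 0 (fun σ => (∑ x ∈ box 3 L, spinAt x σ) ^ 2) * t -
          t ^ 3 * (3 * (plusExpect 3 (criticalBeta 3) 0 (fun σ => (∑ x ∈ box 3 L, spinAt x σ) ^ 2)) ^ 2 -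
            plusExpect 3 (criticalBeta 3) 0 (fun σ => (∑ x ∈ box 3 L, spinAt x σ) ^ 4))) *
        plusExpect 3 (criticalBeta 3) 0 (fun σ => Real.exp (t * ∑ x ∈ box 3 L, spinAt x σ)) ≤
      plusExpect 3 (criticalBeta 3) 0
        (fun σ => (∑ x ∈ box 3 L, spinAt x σ) * Real.exp (t * ∑ x ∈ box 3 L, spinAt x σ))) →
    (∀ (ρ : ℝ → ℝ) (Δ : ℝ) (S : CorrFamily 3), (∀ δ ∈ Set.Ioc (0:ℝ) 1, 0 < ρ δ) →
      HasPointwiseScalingLimit (criticalCorr 3) ρ S → IsNondegenerateTwoPoint S →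
      IsScaleCovariant Δ S →
      ∃ C : ℝ, 0 < C ∧ ∀ᶠ L : ℕ in atTop,
        (2 * (L : ℝ) + 1) ^ 3 * magnetizationInField 3 (criticalBeta 3)
            (C / Real.sqrt (plusExpect 3 (criticalBeta 3) 0 (fun σ => (∑ x ∈ box 3 L, spinAt x σ) ^ 2))) ≤
          criticalBeta 3 * C / 2 *
            Real.sqrt (plusExpect 3 (criticalBeta 3) 0 (fun σ => (∑ x ∈ box 3 L, spinAt x σ) ^ 2))) →
    Summit.CriticalPhenomena.Ising3DConformalLimit.Theses.ModularBoosts.IsingEuclidUpgradeR4NonGaussian :=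
  fun hdef hiso => IsingEuclidUpgradeR4NonGaussian_of hdef hiso

/-- … and from the registered stubs of the live skeleton (what a lead on a bet route closes stub by stub). -/
theorem IsingEuclidUpgradeR4NonGaussian_of_stubs_unitLightCone :
    Summit.CriticalPhenomena.Ising3DConformalLimit.Theses.UnitLightCone.IsingEuclidUpgradeR4NonGaussian :=
  IsingEuclidUpgradeR4NonGaussian_of_unitLightCone stub_leeYangDeficit stub_matchedUpperIsotherm

theorem IsingEuclidUpgradeR4NonGaussian_of_stubs_modularBoosts :
    Summit.CriticalPhenomena.Ising3DConformalLimit.Theses.ModularBoosts.IsingEuclidUpgradeR4NonGaussian :=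
  IsingEuclidUpgradeR4NonGaussian_of_modularBoosts stub_leeYangDeficit stub_matchedUpperIsotherm

end Summit.CriticalPhenomena.Ising3DConformalLimit.Cruxes.IsingEuclidUpgradeR4NonGaussian.IsothermSaturationLeeYang

end
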